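import Literature.NumberTheory.EllipticCurves.SkinnerUrban2014.CharacteristicIdealBaseChangeNormalProofs
import Literature.NumberTheory.EllipticCurves.IwasawaAlgebraProofs
import Literature.NumberTheory.EllipticCurves.IwasawaAlgebraCharIdealProofs
import Literature.NumberTheory.EllipticCurves.IwasawaAlgebraMuAdditiveProofs
import Literature.RingTheory.FittingIdeal.BaseChange
import HarnessLib

/-!
# X11b, STEP L at `p ‖ N`: the ONE-SIDED specialisation of a main-conjecture divisibility from a
# Hida family to the `p`-new weight-two point (Castella 2018, proof of Thm. 4.2, read one-sided)
# — pure commutative algebra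

HONEST FRAMING (cell `bsd-stepL`, run/shared/lean/pub/bsd-stepL/, seat `bsd-stepL-bdp`, memo
`HOME/proof/PROOF-BDP.md` §13.2 Theorem B′; planner ruling (R-e), ask (A6)): STEP L (the lower
bound `ord_p #Ш(E/K)[p^∞] ≥ 2·ord_p[E(K):ℤ·y_K] − …`) at a multiplicative prime `p ‖ N` needs only
the Eisenstein-side divisibility `Ch_Λ(X_ac(E[p^∞]))·Λ_{R₀} ⊆ (L_p(f))` (H3). On ROAD HF this
divisibility for the weight-two Steinberg form `f = f_E` is SPECIALISED from the two-variable
divisibility `char_{Λ_𝓡}(X_Gr^Σ(A_𝐟))·Λ_{𝓡,R₀} ⊆ (L_p^Σ(𝐟))` for the Hida family `𝐟` through `f`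
(Wan 2020 Thm. 1.1 (1) + the comparison `(𝓛_p^Σ(𝐟)⁻) = (L_p^Σ(𝐟))`, Castella 2018 p. 10) along
the arithmetic point `℘̃` of `f`, using Castella 2018 Thm. 2.6 (Hida control at the `p`-new point:
`X/℘̃X ≅ X_Gr^Σ(E[p^∞])`) — with NO pseudo-null analysis and NO two-sided equality (Castella 2018
Lemma 4.3 / Ochiai served the equality). THIS FILE proves exactly the abstract algebra of that
passage, i.e. PROOF-BDP Theorem B′ steps (1)–(3) and its Remark (i) (a control map with pseudo-null
— e.g. finite — kernel instead of an isomorphism is absorbed), over the tree's Skinner–Urban 2014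
Cor. 3.2.9 (ii) (`SkinnerUrban2014.charIdeal_baseChange_le_span_singleton_of_isIntegrallyClosed`):
nothing about Selmer groups, Hida families, `p`-adic `L`-functions or the inputs of ROAD HF
(Wan 2020 Thm. 1.1, Castella 2018 Thm. 2.6, Cas20 Thm. 2.11, Hsieh 2014 Thm. B) is asserted here;
the labelled hypotheses of the memo (torsion-ness of `X_Gr^Σ(E[p^∞])` ⟸ Cas18 Thm. 2.3 + rank 1 +
`#Ш[p^∞] < ∞`; `Fitt = Ch` ⟸ no non-zero finite submodule, erratum Lemma 2.2) appear as the
hypotheses `Module.IsTorsion …` / `charIdeal ≤ fittingIdeal` of the theorems. No `sorry`, no new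
definition, no named fact; banked like `X11b/IMCCongruenceTransferKrull.lean` (p396597); no grade
word of TARGET.md depends on it.

## Dictionary (memo ↔ file)
`R` = `Λ_{𝓡,R₀}` (normal Noetherian domain, CLW22 Def. 1.0.1 divisorial `char`), `S` = `Λ_{R₀} =
R₀⟦T⟧` (an `R`-algebra through `℘̃`), `M` = `X_Gr^Σ(A_𝐟) ⊗̂ R₀`, `L` = `L_p^Σ(𝐟)`, `algebraMap R S L`
= `L mod ℘̃ = L_p^Σ(f)`, (HF) = `charIdeal R M ≤ (L)`, `ctl : S ⊗_R M → X` = Cas18 Thm. 2.6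
(`X = X_Gr^Σ(E[p^∞]) ⊗ Λ_{R₀}`), `Λ'` = `Λ` (or `Λ_𝒪`), `Y` = `X_Gr^Σ(E[p^∞])` (= `X_ac^Σ(E[p^∞])`
up to the Tamagawa exponents, Cas18 Prop. 2.5).

## What is proved
* `charIdeal_eq_one_of_isPseudoNull` — a pseudo-null module has characteristic ideal `1`.
* `charIdeal_le_span_singleton_of_isPseudoNull_ker` — Remark (i): if `char(A) ⊆ (ℓ)` and
  `f : A → X` has PSEUDO-NULL kernel (`X` finite torsion), then `char(X) ⊆ (ℓ)` (the cokernel is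
  harmless for the one-sided half: `char X = char(im f)·char(coker) ⊆ char(im f) = char A`).
* `charIdeal_le_span_singleton_of_familyControl` — Theorem B′ (1)–(2) + (i): (HF) over `R`, the
  base change `S ⊗_R M` torsion, a control map `S ⊗_R M → X` with pseudo-null kernel ⟹
  `char_S(X) ⊆ (L·1_S)`.
* `map_fittingIdeal_le_span_singleton_of_familyControl` — with `X = S ⊗_{Λ'} Y`: the ORDER ideal
  of `Y` pushed to `S` lies in `(L·1_S)` (Fitting ideals commute with base change; `char ⊆ (ℓ) ⇒
  Fitt ⊆ (ℓ)` over a normal domain) — step (2) in the memo's direction `Λ → Λ_{R₀}`.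
* `map_charIdeal_le_span_singleton_of_familyControl` — step (3): with `Ch_{Λ'}(Y) ⊆ Fitt_{Λ'}(Y)`
  (no non-zero pseudo-null submodule) the H3-shaped conclusion `Ch_{Λ'}(Y)·S ⊆ (L·1_S)`.

References: [Castella2018] F. Castella, Math. Ann. 370 (2018), Thm. 2.6 and proof of Thm. 4.2
(arXiv:1704.06608 pp. 8–11); [SkinnerUrban2014] Cor. 3.2.9 (ii) (p. 24) and §3.1.6;
[Castella2018Erratum] Lemma 2.2; Bourbaki AC VII §4.4–4.5 (pseudo-null modules, multiplicativity
of `char`); [StacksProject] Tag 07ZA (3).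
-/

noncomputable section

open scoped TensorProduct

open Literature.RingTheory.FittingIdeal Literature.NumberTheory.EllipticCurves
  Literature.NumberTheory.EllipticCurves.Module Literature.NumberTheory.EllipticCurves.SkinnerUrban2014

namespace Summit.BirchSwinnertonDyer.Rank1Residual.X11b.FamilySpecialization

universe u v w x y

/-! ### Pseudo-null modules do not contribute to characteristic ideals -/

section PseudoNull

variable {S : Type w} [CommRing S]

/-- **A pseudo-null module has characteristic ideal `1`**: every local length at a height-one
prime vanishes, so every factor of `char = ∏_{ht 𝔭 = 1} 𝔭^{length}` is `𝔭⁰ = 1` (Bourbaki AC VII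
§4.5: `char` factors through the quotient category modulo pseudo-null modules).
[cite: Washington1997, §13.2] -/
theorem charIdeal_eq_one_of_isPseudoNull {K : Type x} [AddCommGroup K] [Module S K]
    (hK : Module.IsPseudoNull S K) : charIdeal S K = 1 := by
  unfold charIdeal
  refine finprod_mem_of_eqOn_one fun 𝔭 h𝔭 => ?_
  have h0 : lengthAt S K 𝔭 = 0 := (lengthAt_eq_zero_iff 𝔭).mpr (hK 𝔭 (le_of_eq h𝔭))
  rw [Pi.one_apply, h0, ENat.toNat_zero, pow_zero]

variable [IsNoetherianRing S] [IsDomain S]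

/-- **Remark (i) of PROOF-BDP Thm. B′: a control map with pseudo-null kernel is as good as an
isomorphism for the ONE-SIDED divisibility.** Over a Noetherian domain `S`, let `A` be finite
torsion with `char(A) ⊆ (ℓ)` and `f : A → X` `S`-linear with PSEUDO-NULL kernel, `X` finite torsion.
Then `char(X) ⊆ (ℓ)`: `char(A) = char(ker f)·char(im f) = char(im f)` and
`char(X) = char(im f)·char(X/im f) ⊆ char(im f)` (multiplicativity in short exact sequences; the
cokernel only makes `char(X)` MORE divisible). [cite: Castella2018, Thm. 2.6 (arXiv:1704.06608 p. 8)]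
[cite: Washington1997, §13.2] -/
theorem charIdeal_le_span_singleton_of_isPseudoNull_ker
    {A : Type x} [AddCommGroup A] [Module S A] [Module.Finite S A]
    {X : Type y} [AddCommGroup X] [Module S X] [Module.Finite S X]
    (hA : Module.IsTorsion S A) (hX : Module.IsTorsion S X) {ℓ : S}
    (hAℓ : charIdeal S A ≤ Ideal.span {ℓ}) (f : A →ₗ[S] X)
    (hker : Module.IsPseudoNull S (LinearMap.ker f)) :
    charIdeal S X ≤ Ideal.span {ℓ} := by
  -- `char(A) = char(ker f) · char(im f) = char(im f)`
  have h1 : charIdeal S A = charIdeal S (LinearMap.ker f) * charIdeal S (LinearMap.range f) :=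
    charIdeal_eq_mul_of_exact hA (LinearMap.ker f).subtype f.rangeRestrict
      (Submodule.subtype_injective _) f.surjective_rangeRestrict
      (LinearMap.exact_iff.mpr (by rw [LinearMap.ker_rangeRestrict, Submodule.range_subtype]))
  rw [charIdeal_eq_one_of_isPseudoNull hker, one_mul] at h1
  -- `char(X) = char(im f) · char(X / im f) ⊆ char(im f)`
  have h2 : charIdeal S X =
      charIdeal S (LinearMap.range f) * charIdeal S (X ⧸ LinearMap.range f) :=
    charIdeal_eq_mul_of_exact hX (LinearMap.range f).subtype (LinearMap.range f).mkQ
      (Submodule.subtype_injective _) (Submodule.mkQ_surjective _) (LinearMap.exact_subtype_mkQ _)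
  rw [h2, ← h1]
  exact Ideal.mul_le_right.trans hAℓ

end PseudoNull

/-! ### Theorem B′: one-sided specialisation along `R → S` through a control map -/

section FamilyControl

variable {R : Type u} [CommRing R] [IsDomain R] [IsNoetherianRing R] [IsIntegrallyClosed R]
  {S : Type w} [CommRing S] [Algebra R S] [IsNoetherianRing S] [IsDomain S] [IsIntegrallyClosed S]
  {M : Type v} [AddCommGroup M] [Module R M] [Module.Finite R M]
  {X : Type y} [AddCommGroup X] [Module S X] [Module.Finite S X]

/-- **PROOF-BDP Theorem B′, steps (1)–(2) with Remark (i) (one-sided specialisation from the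
family).** `R` and `S` Noetherian normal domains, `S` an `R`-algebra (the specialisation
`Λ_{𝓡,R₀} → Λ_{𝓡,R₀}/℘̃ = Λ_{R₀}`), `M` a finite `R`-module with (HF) `char_R(M) ⊆ (L)`, the base
change `S ⊗_R M = M/℘̃M` TORSION (labelled input (0): Cas18 Thm. 2.3 — rank one and `#Ш[p^∞] < ∞`
— transported through Thm. 2.6), and an `S`-linear control map `S ⊗_R M → X` with PSEUDO-NULL
kernel onto-or-not a finite torsion `X` (Cas18 Thm. 2.6 gives an isomorphism). Then
`char_S(X) ⊆ (L·1_S)`: Skinner–Urban Cor. 3.2.9 (ii) in base-change form (tree theorem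
`charIdeal_baseChange_le_span_singleton_of_isIntegrallyClosed`: `Fitt ⊆ char ⊆ (L)`, Fitting
ideals commute with base change, `char` is the smallest divisorial ideal over `Fitt`) and
`charIdeal_le_span_singleton_of_isPseudoNull_ker`. No pseudo-nullity of `X` itself, no
`Ch = Fitt`, no two-sided statement is used or claimed.
[cite: Castella2018, Thm. 2.6 and proof of Thm. 4.2 (arXiv:1704.06608 pp. 8–11)]
[cite: SkinnerUrban2014, Cor. 3.2.9 (ii) (p. 24)] -/
theorem charIdeal_le_span_singleton_of_familyControl {L : R}
    (hHF : charIdeal R M ≤ Ideal.span {L}) (hT : Module.IsTorsion S (S ⊗[R] M))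
    (hX : Module.IsTorsion S X) (ctl : S ⊗[R] M →ₗ[S] X)
    (hker : Module.IsPseudoNull S (LinearMap.ker ctl)) :
    charIdeal S X ≤ Ideal.span {algebraMap R S L} :=
  charIdeal_le_span_singleton_of_isPseudoNull_ker hT hX
    (charIdeal_baseChange_le_span_singleton_of_isIntegrallyClosed (M := M) S hHF hT) ctl hker

variable {Λ' : Type x} [CommRing Λ'] [Algebra Λ' S]
  {Y : Type y} [AddCommGroup Y] [Module Λ' Y] [Module.Finite Λ' Y]

/-- **PROOF-BDP Theorem B′, step (2) in the direction `Λ → Λ_{R₀}` (order-ideal form).** In the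
setting of `charIdeal_le_span_singleton_of_familyControl` let the target of the control map be the
base change `S ⊗_{Λ'} Y` of a finite `Λ'`-module `Y` along ANY ring map `Λ' → S` (`Λ = ℤ_p⟦T⟧ →
Λ_{R₀} = R₀⟦T⟧`, `Y = X_Gr^Σ(E[p^∞])`). Then the ORDER ideal of `Y` specialises into `(L·1_S)`:
`Fitt_{Λ'}(Y)·S = Fitt_S(S ⊗_{Λ'} Y) ⊆ (L·1_S)` — Fitting ideals commute with base change
(Stacks 07ZA (3)) and over the normal domain `S` a principal ideal containing `char_S` contains
`Fitt_S` (S–U §3.1.6, tree theorem `fittingIdeal_zero_le_span_singleton_of_charIdeal_le`).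
[cite: Castella2018, Thm. 2.6 and proof of Thm. 4.2 (arXiv:1704.06608 pp. 8–11)]
[cite: SkinnerUrban2014, §3.1.6 (p. 20) and Cor. 3.2.9 (ii) (p. 24)] [cite: StacksProject, Tag 07ZA] -/
theorem map_fittingIdeal_le_span_singleton_of_familyControl {L : R}
    (hHF : charIdeal R M ≤ Ideal.span {L}) (hT : Module.IsTorsion S (S ⊗[R] M))
    (hY : Module.IsTorsion S (S ⊗[Λ'] Y)) (ctl : S ⊗[R] M →ₗ[S] S ⊗[Λ'] Y)
    (hker : Module.IsPseudoNull S (LinearMap.ker ctl)) :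
    (Module.fittingIdeal Λ' Y 0).map (algebraMap Λ' S) ≤ Ideal.span {algebraMap R S L} := by
  rw [← Module.fittingIdeal_baseChange]
  exact fittingIdeal_zero_le_span_singleton_of_charIdeal_le
    (charIdeal_le_span_singleton_of_familyControl hHF hT hY ctl hker)

/-- **PROOF-BDP Theorem B′, step (3) — the H3-shaped conclusion `Ch_Λ(Y)·Λ_{R₀} ⊆ (L_p(f))`.**
If moreover `Ch_{Λ'}(Y) ⊆ Fitt_{Λ'}(Y)` (labelled input: `Y` has no non-zero pseudo-null — over
`Λ`, finite — submodule, so that `Ch = Fitt`; erratum Lemma 2.2 / Greenberg 2016 for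
`X_ac^Σ(E[p^∞])`), then `Ch_{Λ'}(Y)·S ⊆ (L·1_S)`. With `Λ' = Λ`, `S = Λ_{R₀}`, `L·1_S = L_p^Σ(f)`
this is the Σ-imprimitive divisibility (H3) of STEP L, obtained ONE-SIDEDLY from (HF).
[cite: Castella2018, Thm. 2.6 and proof of Thm. 4.2 (arXiv:1704.06608 pp. 8–11)]
[cite: Castella2018Erratum, Lemma 2.2] [cite: SkinnerUrban2014, Cor. 3.2.9 (ii) (p. 24)] -/
theorem map_charIdeal_le_span_singleton_of_familyControl {L : R}
    (hHF : charIdeal R M ≤ Ideal.span {L}) (hT : Module.IsTorsion S (S ⊗[R] M))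
    (hY : Module.IsTorsion S (S ⊗[Λ'] Y)) (ctl : S ⊗[R] M →ₗ[S] S ⊗[Λ'] Y)
    (hker : Module.IsPseudoNull S (LinearMap.ker ctl))
    (hChFitt : charIdeal Λ' Y ≤ Module.fittingIdeal Λ' Y 0) :
    (charIdeal Λ' Y).map (algebraMap Λ' S) ≤ Ideal.span {algebraMap R S L} :=
  (Ideal.map_mono hChFitt).trans (map_fittingIdeal_le_span_singleton_of_familyControl hHF hT hY ctl hker)

end FamilyControl

end Summit.BirchSwinnertonDyer.Rank1Residual.X11b.FamilySpecialization

end
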